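import Literature.NumberTheory.EllipticCurves.WeierstrassAddLawTwo
import HarnessLib

/-!
# The second addition law is proportional to Mathlib's on `E × E`

For point representatives `P, Q` satisfying the Weierstrass equation, the second addition law
`add₂XYZ P Q` of `EllipticCurves/WeierstrassAddLawTwo` and Mathlib's `addXYZ P Q` are proportional:
the `2 × 2` minors `add₂X · addZ − add₂Z · addX` and `add₂Y · addZ − add₂Z · addY` vanish
(`add₂X_mul_addZ`, `add₂Y_mul_addZ`; the third minor follows wherever `addZ ≠ 0`,
`add₂X_mul_addY`). Both laws are thus sections of the same space of addition laws of bidegree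
`(2, 2)` (Bosma–Lenstra 1995, Theorem 2) and represent the same point `P + Q` wherever they are
non-zero. The proofs are `linear_combination` with explicit cofactors in `F(P)` and `F(Q)` found by
computer algebra (exact division) and verified by the kernel.

## References

* [BosmaLenstra1995] W. Bosma, H. W. Lenstra, J. Number Theory 53 (1995), 229–240: Theorem 2, §5.
-/

local notation3 "x" => (0 : Fin 3)

local notation3 "y" => (1 : Fin 3)

local notation3 "z" => (2 : Fin 3)

universe r

namespace WeierstrassCurve.Projective

variable {R : Type r} [CommRing R] {W' : Projective R}

set_option maxHeartbeats 1600000 in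
set_option maxRecDepth 16000 in
-- polynomial identity with several thousand monomials (kernel-checked certificate)
/-- **The minor `add₂X · addZ − add₂Z · addX` vanishes on `E × E`.** [cite: BosmaLenstra1995, Theorem 2] -/
theorem add₂X_mul_addZ {P Q : Fin 3 → R} (hP : W'.Equation P) (hQ : W'.Equation Q) :
    W'.add₂X P Q * W'.addZ P Q = W'.add₂Z P Q * W'.addX P Q := by
  linear_combination (norm := (rw [add₂X, add₂Z, addZ, addX]; ring1))
    (-3 * P z * Q x * Q y ^ 3 - 3 * P y * Q x * Q y ^ 2 * Q z
      - 9 * W'.a₆ * P z * Q x * Q y * Q z ^ 2 - 9 * W'.a₆ * P y * Q x * Q z ^ 3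
      - 3 * W'.a₄ * P z * Q x ^ 2 * Q y * Q z - 3 * W'.a₄ * P y * Q x ^ 2 * Q z ^ 2
      + W'.a₄ ^ 2 * P z * Q y * Q z ^ 3 + W'.a₄ ^ 2 * P y * Q z ^ 4
      - 6 * W'.a₃ * P z * Q x * Q y ^ 2 * Q z - 3 * W'.a₃ * P y * Q x * Q y * Q z ^ 2
      - 9 * W'.a₃ * W'.a₆ * P z * Q x * Q z ^ 3 - 3 * W'.a₃ * W'.a₄ * P z * Q x ^ 2 * Q z ^ 2
      + W'.a₃ * W'.a₄ ^ 2 * P z * Q z ^ 4 - 6 * W'.a₃ ^ 2 * P z * Q x * Q y * Q z ^ 2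
      - 3 * W'.a₃ ^ 2 * P y * Q x * Q z ^ 3 - 3 * W'.a₃ ^ 3 * P z * Q x * Q z ^ 3
      - W'.a₂ * P z * Q y ^ 3 * Q z - W'.a₂ * P y * Q y ^ 2 * Q z ^ 2
      - 3 * W'.a₂ * W'.a₆ * P z * Q y * Q z ^ 3 - 3 * W'.a₂ * W'.a₆ * P y * Q z ^ 4
      + W'.a₂ * W'.a₄ * P z * Q x * Q y * Q z ^ 2 + W'.a₂ * W'.a₄ * P y * Q x * Q z ^ 3
      - 2 * W'.a₂ * W'.a₃ * P z * Q y ^ 2 * Q z ^ 2 - W'.a₂ * W'.a₃ * P y * Q y * Q z ^ 3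
      - 3 * W'.a₂ * W'.a₃ * W'.a₆ * P z * Q z ^ 4 + W'.a₂ * W'.a₃ * W'.a₄ * P z * Q x * Q z ^ 3
      - 2 * W'.a₂ * W'.a₃ ^ 2 * P z * Q y * Q z ^ 3 - W'.a₂ * W'.a₃ ^ 2 * P y * Q z ^ 4
      - W'.a₂ * W'.a₃ ^ 3 * P z * Q z ^ 4 + W'.a₂ ^ 2 * P z * Q x ^ 2 * Q y * Q z
      + W'.a₂ ^ 2 * P y * Q x ^ 2 * Q z ^ 2 + W'.a₂ ^ 2 * W'.a₃ * P z * Q x ^ 2 * Q z ^ 2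
      - 6 * W'.a₁ * P z * Q x ^ 2 * Q y ^ 2 - 3 * W'.a₁ * P y * Q x ^ 2 * Q y * Q z
      - 9 * W'.a₁ * W'.a₆ * P z * Q x ^ 2 * Q z ^ 2 - 3 * W'.a₁ * W'.a₄ * P z * Q x ^ 3 * Q z
      + W'.a₁ * W'.a₄ ^ 2 * P z * Q x * Q z ^ 3 - 9 * W'.a₁ * W'.a₃ * P z * Q x ^ 2 * Q y * Q z
      - 3 * W'.a₁ * W'.a₃ * P y * Q x ^ 2 * Q z ^ 2 + W'.a₁ * W'.a₃ * W'.a₄ * P z * Q y * Q z ^ 3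
      + W'.a₁ * W'.a₃ * W'.a₄ * P y * Q z ^ 4 - 6 * W'.a₁ * W'.a₃ ^ 2 * P z * Q x ^ 2 * Q z ^ 2
      + W'.a₁ * W'.a₃ ^ 2 * W'.a₄ * P z * Q z ^ 4 - 2 * W'.a₁ * W'.a₂ * P z * Q x * Q y ^ 2 * Q z
      - W'.a₁ * W'.a₂ * P y * Q x * Q y * Q z ^ 2 - 3 * W'.a₁ * W'.a₂ * W'.a₆ * P z * Q x * Q z ^ 3
      + W'.a₁ * W'.a₂ * W'.a₄ * P z * Q x ^ 2 * Q z ^ 2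
      - 2 * W'.a₁ * W'.a₂ * W'.a₃ * P z * Q x * Q y * Q z ^ 2
      - W'.a₁ * W'.a₂ * W'.a₃ ^ 2 * P z * Q x * Q z ^ 3 + W'.a₁ * W'.a₂ ^ 2 * P z * Q x ^ 3 * Q z
      - W'.a₁ ^ 2 * P z * Q y ^ 3 * Q z - 3 * W'.a₁ ^ 2 * P z * Q x ^ 3 * Q y
      - W'.a₁ ^ 2 * P y * Q y ^ 2 * Q z ^ 2 + W'.a₁ ^ 2 * W'.a₄ * P z * Q x * Q y * Q z ^ 2
      + W'.a₁ ^ 2 * W'.a₄ * P y * Q x * Q z ^ 3 - 2 * W'.a₁ ^ 2 * W'.a₃ * P z * Q y ^ 2 * Q z ^ 2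
      - 3 * W'.a₁ ^ 2 * W'.a₃ * P z * Q x ^ 3 * Q z - W'.a₁ ^ 2 * W'.a₃ * P y * Q y * Q z ^ 3
      + 2 * W'.a₁ ^ 2 * W'.a₃ * W'.a₄ * P z * Q x * Q z ^ 3
      - W'.a₁ ^ 2 * W'.a₃ ^ 2 * P z * Q y * Q z ^ 3 + W'.a₁ ^ 2 * W'.a₂ * P y * Q x ^ 2 * Q z ^ 2
      + W'.a₁ ^ 2 * W'.a₂ * W'.a₃ * P z * Q x ^ 2 * Q z ^ 2
      - 2 * W'.a₁ ^ 3 * P z * Q x * Q y ^ 2 * Q z - W'.a₁ ^ 3 * P y * Q x * Q y * Q z ^ 2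
      + W'.a₁ ^ 3 * W'.a₄ * P z * Q x ^ 2 * Q z ^ 2
      - 2 * W'.a₁ ^ 3 * W'.a₃ * P z * Q x * Q y * Q z ^ 2 + W'.a₁ ^ 3 * W'.a₂ * P z * Q x ^ 3 * Q z
      - W'.a₁ ^ 4 * P z * Q x ^ 2 * Q y * Q z) * (equation_iff P).mp hP
    + (3 * P x * P y ^ 2 * P z * Q y + 3 * P x * P y ^ 3 * Q z + 9 * W'.a₆ * P x * P z ^ 3 * Q y
      + 9 * W'.a₆ * P x * P y * P z ^ 2 * Q z + 3 * W'.a₄ * P x ^ 2 * P z ^ 2 * Q y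
      + 3 * W'.a₄ * P x ^ 2 * P y * P z * Q z - W'.a₄ ^ 2 * P z ^ 4 * Q y
      - W'.a₄ ^ 2 * P y * P z ^ 3 * Q z + 3 * W'.a₃ * P x * P y * P z ^ 2 * Q y
      + 6 * W'.a₃ * P x * P y ^ 2 * P z * Q z + 9 * W'.a₃ * W'.a₆ * P x * P z ^ 3 * Q z
      + 3 * W'.a₃ * W'.a₄ * P x ^ 2 * P z ^ 2 * Q z - W'.a₃ * W'.a₄ ^ 2 * P z ^ 4 * Q z
      + 3 * W'.a₃ ^ 2 * P x * P z ^ 3 * Q y + 6 * W'.a₃ ^ 2 * P x * P y * P z ^ 2 * Q z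
      + 3 * W'.a₃ ^ 3 * P x * P z ^ 3 * Q z + W'.a₂ * P y ^ 2 * P z ^ 2 * Q y
      + W'.a₂ * P y ^ 3 * P z * Q z + 3 * W'.a₂ * W'.a₆ * P z ^ 4 * Q y
      + 3 * W'.a₂ * W'.a₆ * P y * P z ^ 3 * Q z - W'.a₂ * W'.a₄ * P x * P z ^ 3 * Q y
      - W'.a₂ * W'.a₄ * P x * P y * P z ^ 2 * Q z + W'.a₂ * W'.a₃ * P y * P z ^ 3 * Q y
      + 2 * W'.a₂ * W'.a₃ * P y ^ 2 * P z ^ 2 * Q z + 3 * W'.a₂ * W'.a₃ * W'.a₆ * P z ^ 4 * Q z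
      - W'.a₂ * W'.a₃ * W'.a₄ * P x * P z ^ 3 * Q z + W'.a₂ * W'.a₃ ^ 2 * P z ^ 4 * Q y
      + 2 * W'.a₂ * W'.a₃ ^ 2 * P y * P z ^ 3 * Q z + W'.a₂ * W'.a₃ ^ 3 * P z ^ 4 * Q z
      - W'.a₂ ^ 2 * P x ^ 2 * P z ^ 2 * Q y - W'.a₂ ^ 2 * P x ^ 2 * P y * P z * Q z
      - W'.a₂ ^ 2 * W'.a₃ * P x ^ 2 * P z ^ 2 * Q z + 3 * W'.a₁ * P x * P y ^ 2 * P z * Q x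
      + 3 * W'.a₁ * P x ^ 2 * P y * P z * Q y + 3 * W'.a₁ * P x ^ 2 * P y ^ 2 * Q z
      + 9 * W'.a₁ * W'.a₆ * P x * P z ^ 3 * Q x + 3 * W'.a₁ * W'.a₄ * P x ^ 2 * P z ^ 2 * Q x
      - W'.a₁ * W'.a₄ ^ 2 * P z ^ 4 * Q x + 3 * W'.a₁ * W'.a₃ * P x * P y * P z ^ 2 * Q x
      + 3 * W'.a₁ * W'.a₃ * P x ^ 2 * P z ^ 2 * Q y + 6 * W'.a₁ * W'.a₃ * P x ^ 2 * P y * P z * Q z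
      - W'.a₁ * W'.a₃ * W'.a₄ * P z ^ 4 * Q y - W'.a₁ * W'.a₃ * W'.a₄ * P y * P z ^ 3 * Q z
      + 3 * W'.a₁ * W'.a₃ ^ 2 * P x * P z ^ 3 * Q x
      + 3 * W'.a₁ * W'.a₃ ^ 2 * P x ^ 2 * P z ^ 2 * Q z - W'.a₁ * W'.a₃ ^ 2 * W'.a₄ * P z ^ 4 * Q z
      + W'.a₁ * W'.a₂ * P y ^ 2 * P z ^ 2 * Q x + W'.a₁ * W'.a₂ * P x * P y * P z ^ 2 * Q y
      + W'.a₁ * W'.a₂ * P x * P y ^ 2 * P z * Q z + 3 * W'.a₁ * W'.a₂ * W'.a₆ * P z ^ 4 * Q x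
      - W'.a₁ * W'.a₂ * W'.a₄ * P x * P z ^ 3 * Q x + W'.a₁ * W'.a₂ * W'.a₃ * P y * P z ^ 3 * Q x
      + W'.a₁ * W'.a₂ * W'.a₃ * P x * P y * P z ^ 2 * Q z
      + W'.a₁ * W'.a₂ * W'.a₃ ^ 2 * P z ^ 4 * Q x - W'.a₁ * W'.a₂ ^ 2 * P x ^ 2 * P z ^ 2 * Q x
      + W'.a₁ ^ 2 * P y ^ 2 * P z ^ 2 * Q y + W'.a₁ ^ 2 * P y ^ 3 * P z * Q z
      + 3 * W'.a₁ ^ 2 * P x ^ 2 * P y * P z * Q x - W'.a₁ ^ 2 * W'.a₄ * P x * P z ^ 3 * Q y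
      - W'.a₁ ^ 2 * W'.a₄ * P x * P y * P z ^ 2 * Q z + W'.a₁ ^ 2 * W'.a₃ * P y * P z ^ 3 * Q y
      + 2 * W'.a₁ ^ 2 * W'.a₃ * P y ^ 2 * P z ^ 2 * Q z
      + 3 * W'.a₁ ^ 2 * W'.a₃ * P x ^ 2 * P z ^ 2 * Q x - W'.a₁ ^ 2 * W'.a₃ * W'.a₄ * P z ^ 4 * Q x
      - W'.a₁ ^ 2 * W'.a₃ * W'.a₄ * P x * P z ^ 3 * Q z
      + W'.a₁ ^ 2 * W'.a₃ ^ 2 * P y * P z ^ 3 * Q z + W'.a₁ ^ 2 * W'.a₂ * P x * P y * P z ^ 2 * Q x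
      - W'.a₁ ^ 2 * W'.a₂ * P x ^ 2 * P z ^ 2 * Q y - W'.a₁ ^ 2 * W'.a₂ * P x ^ 2 * P y * P z * Q z
      - W'.a₁ ^ 2 * W'.a₂ * W'.a₃ * P x ^ 2 * P z ^ 2 * Q z + W'.a₁ ^ 3 * P y ^ 2 * P z ^ 2 * Q x
      + W'.a₁ ^ 3 * P x * P y * P z ^ 2 * Q y + W'.a₁ ^ 3 * P x * P y ^ 2 * P z * Q z
      - W'.a₁ ^ 3 * W'.a₄ * P x * P z ^ 3 * Q x + W'.a₁ ^ 3 * W'.a₃ * P y * P z ^ 3 * Q x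
      + W'.a₁ ^ 3 * W'.a₃ * P x * P y * P z ^ 2 * Q z - W'.a₁ ^ 3 * W'.a₂ * P x ^ 2 * P z ^ 2 * Q x
      + W'.a₁ ^ 4 * P x * P y * P z ^ 2 * Q x) * (equation_iff Q).mp hQ

set_option maxHeartbeats 3200000 in
set_option maxRecDepth 16000 in
-- polynomial identity with several thousand monomials (kernel-checked certificate)
/-- **The minor `add₂Y · addZ − add₂Z · addY` vanishes on `E × E`.** [cite: BosmaLenstra1995, Theorem 2] -/
theorem add₂Y_mul_addZ {P Q : Fin 3 → R} (hP : W'.Equation P) (hQ : W'.Equation Q) :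
    W'.add₂Y P Q * W'.addZ P Q = W'.add₂Z P Q * W'.addY P Q := by
  linear_combination (norm := (rw [add₂Y, add₂Z, addY, negY_eq, negAddY, addX, addZ]; ring1))
    (9 * P x * Q x ^ 2 * Q y ^ 2 + 27 * W'.a₆ * P x * Q x ^ 2 * Q z ^ 2
      + 12 * W'.a₄ * P z * Q x * Q y ^ 2 * Q z - 9 * W'.a₄ * P z * Q x ^ 4
      + 9 * W'.a₄ * P x * Q x ^ 3 * Q z - 6 * W'.a₄ ^ 2 * P z * Q x ^ 2 * Q z ^ 2
      - 3 * W'.a₄ ^ 2 * P x * Q x * Q z ^ 3 - W'.a₄ ^ 3 * P z * Q z ^ 4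
      + 9 * W'.a₃ * P x * Q x ^ 2 * Q y * Q z + 12 * W'.a₃ * W'.a₄ * P z * Q x * Q y * Q z ^ 2
      + 9 * W'.a₃ ^ 2 * P x * Q x ^ 2 * Q z ^ 2 + 3 * W'.a₃ ^ 2 * W'.a₄ * P z * Q x * Q z ^ 3
      + 3 * W'.a₂ * P z * Q x ^ 2 * Q y ^ 2 + 6 * W'.a₂ * P x * Q x * Q y ^ 2 * Q z
      + 9 * W'.a₂ * W'.a₆ * P z * Q x ^ 2 * Q z ^ 2 + 18 * W'.a₂ * W'.a₆ * P x * Q x * Q z ^ 3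
      + 4 * W'.a₂ * W'.a₄ * P z * Q y ^ 2 * Q z ^ 2 - 9 * W'.a₂ * W'.a₄ * P z * Q x ^ 3 * Q z
      - 5 * W'.a₂ * W'.a₄ ^ 2 * P z * Q x * Q z ^ 3 - W'.a₂ * W'.a₄ ^ 2 * P x * Q z ^ 4
      + 3 * W'.a₂ * W'.a₃ * P z * Q x ^ 2 * Q y * Q z
      + 6 * W'.a₂ * W'.a₃ * P x * Q x * Q y * Q z ^ 2
      + 4 * W'.a₂ * W'.a₃ * W'.a₄ * P z * Q y * Q z ^ 3
      + 3 * W'.a₂ * W'.a₃ ^ 2 * P z * Q x ^ 2 * Q z ^ 2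
      + 6 * W'.a₂ * W'.a₃ ^ 2 * P x * Q x * Q z ^ 3 + W'.a₂ * W'.a₃ ^ 2 * W'.a₄ * P z * Q z ^ 4
      - 2 * W'.a₂ ^ 2 * P z * Q x * Q y ^ 2 * Q z + 3 * W'.a₂ ^ 2 * P z * Q x ^ 4
      + W'.a₂ ^ 2 * P x * Q y ^ 2 * Q z ^ 2 - 3 * W'.a₂ ^ 2 * P x * Q x ^ 3 * Q z
      + 6 * W'.a₂ ^ 2 * W'.a₆ * P z * Q x * Q z ^ 3 + 3 * W'.a₂ ^ 2 * W'.a₆ * P x * Q z ^ 4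
      - 2 * W'.a₂ ^ 2 * W'.a₄ * P z * Q x ^ 2 * Q z ^ 2 - W'.a₂ ^ 2 * W'.a₄ * P x * Q x * Q z ^ 3
      - 2 * W'.a₂ ^ 2 * W'.a₃ * P z * Q x * Q y * Q z ^ 2 + W'.a₂ ^ 2 * W'.a₃ * P x * Q y * Q z ^ 3
      + W'.a₂ ^ 2 * W'.a₃ ^ 2 * P z * Q x * Q z ^ 3 + W'.a₂ ^ 2 * W'.a₃ ^ 2 * P x * Q z ^ 4
      - W'.a₂ ^ 3 * P z * Q y ^ 2 * Q z ^ 2 + 3 * W'.a₂ ^ 3 * P z * Q x ^ 3 * Q z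
      - W'.a₂ ^ 3 * P x * Q x ^ 2 * Q z ^ 2 + W'.a₂ ^ 3 * W'.a₆ * P z * Q z ^ 4
      + W'.a₂ ^ 3 * W'.a₄ * P z * Q x * Q z ^ 3 - W'.a₂ ^ 3 * W'.a₃ * P z * Q y * Q z ^ 3
      + W'.a₂ ^ 4 * P z * Q x ^ 2 * Q z ^ 2 + 3 * W'.a₁ * P z * Q x * Q y ^ 3
      + 9 * W'.a₁ * P y * Q x * Q y ^ 2 * Q z - 9 * W'.a₁ * P y * Q x ^ 4
      + 9 * W'.a₁ * P x * Q x ^ 3 * Q y + 9 * W'.a₁ * W'.a₆ * P z * Q x * Q y * Q z ^ 2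
      - 9 * W'.a₁ * W'.a₆ * P y * Q x * Q z ^ 3 + 15 * W'.a₁ * W'.a₄ * P z * Q x ^ 2 * Q y * Q z
      - 9 * W'.a₁ * W'.a₄ * P y * Q x ^ 2 * Q z ^ 2 - W'.a₁ * W'.a₄ ^ 2 * P z * Q y * Q z ^ 3
      + 15 * W'.a₁ * W'.a₃ * P z * Q x * Q y ^ 2 * Q z - 9 * W'.a₁ * W'.a₃ * P z * Q x ^ 4
      + 9 * W'.a₁ * W'.a₃ * P y * Q x * Q y * Q z ^ 2 + 9 * W'.a₁ * W'.a₃ * P x * Q x ^ 3 * Q z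
      - 3 * W'.a₁ * W'.a₃ * W'.a₄ * P z * Q x ^ 2 * Q z ^ 2
      - 3 * W'.a₁ * W'.a₃ * W'.a₄ * P x * Q x * Q z ^ 3
      - 2 * W'.a₁ * W'.a₃ * W'.a₄ ^ 2 * P z * Q z ^ 4
      + 15 * W'.a₁ * W'.a₃ ^ 2 * P z * Q x * Q y * Q z ^ 2
      + 3 * W'.a₁ * W'.a₃ ^ 3 * P z * Q x * Q z ^ 3 + W'.a₁ * W'.a₂ * P z * Q y ^ 3 * Q z
      + 3 * W'.a₁ * W'.a₂ * P z * Q x ^ 3 * Q y + 3 * W'.a₁ * W'.a₂ * P y * Q y ^ 2 * Q z ^ 2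
      - 12 * W'.a₁ * W'.a₂ * P y * Q x ^ 3 * Q z + 6 * W'.a₁ * W'.a₂ * P x * Q x ^ 2 * Q y * Q z
      + 3 * W'.a₁ * W'.a₂ * W'.a₆ * P z * Q y * Q z ^ 3 - 3 * W'.a₁ * W'.a₂ * W'.a₆ * P y * Q z ^ 4
      + 3 * W'.a₁ * W'.a₂ * W'.a₄ * P z * Q x * Q y * Q z ^ 2
      - 3 * W'.a₁ * W'.a₂ * W'.a₄ * P y * Q x * Q z ^ 3
      + 5 * W'.a₁ * W'.a₂ * W'.a₃ * P z * Q y ^ 2 * Q z ^ 2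
      - 9 * W'.a₁ * W'.a₂ * W'.a₃ * P z * Q x ^ 3 * Q z
      + 3 * W'.a₁ * W'.a₂ * W'.a₃ * P y * Q y * Q z ^ 3
      + 3 * W'.a₁ * W'.a₂ * W'.a₃ * P x * Q x ^ 2 * Q z ^ 2
      - 5 * W'.a₁ * W'.a₂ * W'.a₃ * W'.a₄ * P z * Q x * Q z ^ 3
      - W'.a₁ * W'.a₂ * W'.a₃ * W'.a₄ * P x * Q z ^ 4
      + 5 * W'.a₁ * W'.a₂ * W'.a₃ ^ 2 * P z * Q y * Q z ^ 3
      + W'.a₁ * W'.a₂ * W'.a₃ ^ 3 * P z * Q z ^ 4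
      - 3 * W'.a₁ * W'.a₂ ^ 2 * P z * Q x ^ 2 * Q y * Q z
      - 3 * W'.a₁ * W'.a₂ ^ 2 * P y * Q x ^ 2 * Q z ^ 2
      + W'.a₁ * W'.a₂ ^ 2 * P x * Q x * Q y * Q z ^ 2
      - 4 * W'.a₁ * W'.a₂ ^ 2 * W'.a₃ * P z * Q x ^ 2 * Q z ^ 2
      - W'.a₁ * W'.a₂ ^ 3 * P z * Q x * Q y * Q z ^ 2 + 6 * W'.a₁ ^ 2 * P z * Q x ^ 2 * Q y ^ 2
      + 9 * W'.a₁ ^ 2 * P y * Q x ^ 2 * Q y * Q z + 3 * W'.a₁ ^ 2 * P x * Q x * Q y ^ 2 * Q z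
      + 9 * W'.a₁ ^ 2 * W'.a₆ * P z * Q x ^ 2 * Q z ^ 2
      + W'.a₁ ^ 2 * W'.a₄ * P z * Q y ^ 2 * Q z ^ 2 + 3 * W'.a₁ ^ 2 * W'.a₄ * P z * Q x ^ 3 * Q z
      - 3 * W'.a₁ ^ 2 * W'.a₄ * P x * Q x ^ 2 * Q z ^ 2
      - 2 * W'.a₁ ^ 2 * W'.a₄ ^ 2 * P z * Q x * Q z ^ 3
      + 18 * W'.a₁ ^ 2 * W'.a₃ * P z * Q x ^ 2 * Q y * Q z
      + 3 * W'.a₁ ^ 2 * W'.a₃ * P x * Q x * Q y * Q z ^ 2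
      + 6 * W'.a₁ ^ 2 * W'.a₃ ^ 2 * P z * Q x ^ 2 * Q z ^ 2
      - W'.a₁ ^ 2 * W'.a₃ ^ 2 * W'.a₄ * P z * Q z ^ 4 + 3 * W'.a₁ ^ 2 * W'.a₂ * P z * Q x ^ 4
      + 3 * W'.a₁ ^ 2 * W'.a₂ * P y * Q x * Q y * Q z ^ 2
      + W'.a₁ ^ 2 * W'.a₂ * P x * Q y ^ 2 * Q z ^ 2 - 3 * W'.a₁ ^ 2 * W'.a₂ * P x * Q x ^ 3 * Q z
      + 6 * W'.a₁ ^ 2 * W'.a₂ * W'.a₆ * P z * Q x * Q z ^ 3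
      - W'.a₁ ^ 2 * W'.a₂ * W'.a₄ * P x * Q x * Q z ^ 3
      + 3 * W'.a₁ ^ 2 * W'.a₂ * W'.a₃ * P z * Q x * Q y * Q z ^ 2
      + W'.a₁ ^ 2 * W'.a₂ * W'.a₃ * P x * Q y * Q z ^ 3
      + W'.a₁ ^ 2 * W'.a₂ * W'.a₃ ^ 2 * P z * Q x * Q z ^ 3
      - W'.a₁ ^ 2 * W'.a₂ ^ 2 * P z * Q y ^ 2 * Q z ^ 2
      + 2 * W'.a₁ ^ 2 * W'.a₂ ^ 2 * P z * Q x ^ 3 * Q z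
      - W'.a₁ ^ 2 * W'.a₂ ^ 2 * P x * Q x ^ 2 * Q z ^ 2
      + W'.a₁ ^ 2 * W'.a₂ ^ 2 * W'.a₆ * P z * Q z ^ 4
      + W'.a₁ ^ 2 * W'.a₂ ^ 2 * W'.a₄ * P z * Q x * Q z ^ 3
      - W'.a₁ ^ 2 * W'.a₂ ^ 2 * W'.a₃ * P z * Q y * Q z ^ 3
      + W'.a₁ ^ 2 * W'.a₂ ^ 3 * P z * Q x ^ 2 * Q z ^ 2 + W'.a₁ ^ 3 * P z * Q y ^ 3 * Q z
      + 3 * W'.a₁ ^ 3 * P z * Q x ^ 3 * Q y + 3 * W'.a₁ ^ 3 * P x * Q x ^ 2 * Q y * Q z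
      + 2 * W'.a₁ ^ 3 * W'.a₃ * P z * Q y ^ 2 * Q z ^ 2
      + 3 * W'.a₁ ^ 3 * W'.a₃ * P z * Q x ^ 3 * Q z
      - 2 * W'.a₁ ^ 3 * W'.a₃ * W'.a₄ * P z * Q x * Q z ^ 3
      + W'.a₁ ^ 3 * W'.a₃ ^ 2 * P z * Q y * Q z ^ 3
      - 2 * W'.a₁ ^ 3 * W'.a₂ * P z * Q x ^ 2 * Q y * Q z
      + W'.a₁ ^ 3 * W'.a₂ * P x * Q x * Q y * Q z ^ 2
      - W'.a₁ ^ 3 * W'.a₂ * W'.a₃ * P z * Q x ^ 2 * Q z ^ 2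
      - W'.a₁ ^ 3 * W'.a₂ ^ 2 * P z * Q x * Q y * Q z ^ 2
      + 2 * W'.a₁ ^ 4 * P z * Q x * Q y ^ 2 * Q z - W'.a₁ ^ 4 * W'.a₄ * P z * Q x ^ 2 * Q z ^ 2
      + 2 * W'.a₁ ^ 4 * W'.a₃ * P z * Q x * Q y * Q z ^ 2 - W'.a₁ ^ 4 * W'.a₂ * P z * Q x ^ 3 * Q z
      + W'.a₁ ^ 5 * P z * Q x ^ 2 * Q y * Q z) * (equation_iff P).mp hP
    + (-9 * P x ^ 2 * P y ^ 2 * Q x - 27 * W'.a₆ * P x ^ 2 * P z ^ 2 * Q x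
      - 9 * W'.a₄ * P y ^ 2 * P z ^ 2 * Q x - 3 * W'.a₄ * P x * P y ^ 2 * P z * Q z
      + 9 * W'.a₄ * W'.a₆ * P z ^ 4 * Q x - 9 * W'.a₄ * W'.a₆ * P x * P z ^ 3 * Q z
      + 12 * W'.a₄ ^ 2 * P x * P z ^ 3 * Q x - 3 * W'.a₄ ^ 2 * P x ^ 2 * P z ^ 2 * Q z
      + W'.a₄ ^ 3 * P z ^ 4 * Q z - 9 * W'.a₃ * P x ^ 2 * P y * P z * Q x
      - 9 * W'.a₃ * W'.a₄ * P y * P z ^ 3 * Q x - 3 * W'.a₃ * W'.a₄ * P x * P y * P z ^ 2 * Q z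
      - 9 * W'.a₃ ^ 2 * P x ^ 2 * P z ^ 2 * Q x - 3 * W'.a₃ ^ 2 * W'.a₄ * P x * P z ^ 3 * Q z
      - 6 * W'.a₂ * P x * P y ^ 2 * P z * Q x - 3 * W'.a₂ * P x ^ 2 * P y ^ 2 * Q z
      - 18 * W'.a₂ * W'.a₆ * P x * P z ^ 3 * Q x - 9 * W'.a₂ * W'.a₆ * P x ^ 2 * P z ^ 2 * Q z
      - 4 * W'.a₂ * W'.a₄ * P y ^ 2 * P z ^ 2 * Q z + 9 * W'.a₂ * W'.a₄ * P x ^ 2 * P z ^ 2 * Q x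
      + W'.a₂ * W'.a₄ ^ 2 * P z ^ 4 * Q x + 5 * W'.a₂ * W'.a₄ ^ 2 * P x * P z ^ 3 * Q z
      - 6 * W'.a₂ * W'.a₃ * P x * P y * P z ^ 2 * Q x
      - 3 * W'.a₂ * W'.a₃ * P x ^ 2 * P y * P z * Q z
      - 4 * W'.a₂ * W'.a₃ * W'.a₄ * P y * P z ^ 3 * Q z
      - 6 * W'.a₂ * W'.a₃ ^ 2 * P x * P z ^ 3 * Q x
      - 3 * W'.a₂ * W'.a₃ ^ 2 * P x ^ 2 * P z ^ 2 * Q z - W'.a₂ * W'.a₃ ^ 2 * W'.a₄ * P z ^ 4 * Q z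
      + 2 * W'.a₂ ^ 2 * P y ^ 2 * P z ^ 2 * Q x - W'.a₂ ^ 2 * P x * P y ^ 2 * P z * Q z
      - 6 * W'.a₂ ^ 2 * W'.a₆ * P z ^ 4 * Q x - 3 * W'.a₂ ^ 2 * W'.a₆ * P x * P z ^ 3 * Q z
      - 2 * W'.a₂ ^ 2 * W'.a₄ * P x * P z ^ 3 * Q x
      + 5 * W'.a₂ ^ 2 * W'.a₄ * P x ^ 2 * P z ^ 2 * Q z
      + 2 * W'.a₂ ^ 2 * W'.a₃ * P y * P z ^ 3 * Q x - W'.a₂ ^ 2 * W'.a₃ * P x * P y * P z ^ 2 * Q z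
      - W'.a₂ ^ 2 * W'.a₃ ^ 2 * P z ^ 4 * Q x - W'.a₂ ^ 2 * W'.a₃ ^ 2 * P x * P z ^ 3 * Q z
      + W'.a₂ ^ 3 * P y ^ 2 * P z ^ 2 * Q z - 2 * W'.a₂ ^ 3 * P x ^ 2 * P z ^ 2 * Q x
      - W'.a₂ ^ 3 * W'.a₆ * P z ^ 4 * Q z - W'.a₂ ^ 3 * W'.a₄ * P x * P z ^ 3 * Q z
      + W'.a₂ ^ 3 * W'.a₃ * P y * P z ^ 3 * Q z - W'.a₂ ^ 4 * P x ^ 2 * P z ^ 2 * Q z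
      - 9 * W'.a₁ * P y ^ 3 * P z * Q x - 3 * W'.a₁ * P x * P y ^ 2 * P z * Q y
      + 9 * W'.a₁ * W'.a₆ * P y * P z ^ 3 * Q x - 9 * W'.a₁ * W'.a₆ * P x * P z ^ 3 * Q y
      - 3 * W'.a₁ * W'.a₄ * P x ^ 2 * P z ^ 2 * Q y - 3 * W'.a₁ * W'.a₄ * P x ^ 2 * P y * P z * Q z
      + W'.a₁ * W'.a₄ ^ 2 * P z ^ 4 * Q y - 18 * W'.a₁ * W'.a₃ * P y ^ 2 * P z ^ 2 * Q x
      - 3 * W'.a₁ * W'.a₃ * P x * P y * P z ^ 2 * Q y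
      - 3 * W'.a₁ * W'.a₃ * P x * P y ^ 2 * P z * Q z + 9 * W'.a₁ * W'.a₃ * W'.a₆ * P z ^ 4 * Q x
      - 9 * W'.a₁ * W'.a₃ * W'.a₆ * P x * P z ^ 3 * Q z
      + 12 * W'.a₁ * W'.a₃ * W'.a₄ * P x * P z ^ 3 * Q x
      - 6 * W'.a₁ * W'.a₃ * W'.a₄ * P x ^ 2 * P z ^ 2 * Q z
      + 2 * W'.a₁ * W'.a₃ * W'.a₄ ^ 2 * P z ^ 4 * Q z - 9 * W'.a₁ * W'.a₃ ^ 2 * P y * P z ^ 3 * Q x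
      - 3 * W'.a₁ * W'.a₃ ^ 2 * P x * P z ^ 3 * Q y
      - 3 * W'.a₁ * W'.a₃ ^ 2 * P x * P y * P z ^ 2 * Q z
      - 3 * W'.a₁ * W'.a₃ ^ 3 * P x * P z ^ 3 * Q z - W'.a₁ * W'.a₂ * P y ^ 2 * P z ^ 2 * Q y
      - 3 * W'.a₁ * W'.a₂ * P y ^ 3 * P z * Q z + 3 * W'.a₁ * W'.a₂ * P x ^ 2 * P y * P z * Q x
      - 3 * W'.a₁ * W'.a₂ * W'.a₆ * P z ^ 4 * Q y + 3 * W'.a₁ * W'.a₂ * W'.a₆ * P y * P z ^ 3 * Q z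
      + W'.a₁ * W'.a₂ * W'.a₄ * P x * P z ^ 3 * Q y
      - W'.a₁ * W'.a₂ * W'.a₄ * P x * P y * P z ^ 2 * Q z
      - W'.a₁ * W'.a₂ * W'.a₃ * P y * P z ^ 3 * Q y
      - 7 * W'.a₁ * W'.a₂ * W'.a₃ * P y ^ 2 * P z ^ 2 * Q z
      + 6 * W'.a₁ * W'.a₂ * W'.a₃ * P x ^ 2 * P z ^ 2 * Q x
      + W'.a₁ * W'.a₂ * W'.a₃ * W'.a₄ * P z ^ 4 * Q x
      + 5 * W'.a₁ * W'.a₂ * W'.a₃ * W'.a₄ * P x * P z ^ 3 * Q z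
      - W'.a₁ * W'.a₂ * W'.a₃ ^ 2 * P z ^ 4 * Q y
      - 4 * W'.a₁ * W'.a₂ * W'.a₃ ^ 2 * P y * P z ^ 3 * Q z
      - W'.a₁ * W'.a₂ * W'.a₃ ^ 3 * P z ^ 4 * Q z
      + 2 * W'.a₁ * W'.a₂ ^ 2 * P x * P y * P z ^ 2 * Q x
      + W'.a₁ * W'.a₂ ^ 2 * P x ^ 2 * P z ^ 2 * Q y
      + 2 * W'.a₁ * W'.a₂ ^ 2 * P x ^ 2 * P y * P z * Q z
      + 4 * W'.a₁ * W'.a₂ ^ 2 * W'.a₃ * P x ^ 2 * P z ^ 2 * Q z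
      + W'.a₁ * W'.a₂ ^ 3 * P x * P y * P z ^ 2 * Q z - 15 * W'.a₁ ^ 2 * P x * P y ^ 2 * P z * Q x
      - 3 * W'.a₁ ^ 2 * P x ^ 2 * P y * P z * Q y - 9 * W'.a₁ ^ 2 * W'.a₆ * P x * P z ^ 3 * Q x
      - W'.a₁ ^ 2 * W'.a₄ * P y ^ 2 * P z ^ 2 * Q z + W'.a₁ ^ 2 * W'.a₄ ^ 2 * P z ^ 4 * Q x
      + W'.a₁ ^ 2 * W'.a₄ ^ 2 * P x * P z ^ 3 * Q z
      - 15 * W'.a₁ ^ 2 * W'.a₃ * P x * P y * P z ^ 2 * Q x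
      - 3 * W'.a₁ ^ 2 * W'.a₃ * P x ^ 2 * P z ^ 2 * Q y
      - 3 * W'.a₁ ^ 2 * W'.a₃ * P x ^ 2 * P y * P z * Q z
      + W'.a₁ ^ 2 * W'.a₃ * W'.a₄ * P z ^ 4 * Q y - W'.a₁ ^ 2 * W'.a₃ * W'.a₄ * P y * P z ^ 3 * Q z
      - 3 * W'.a₁ ^ 2 * W'.a₃ ^ 2 * P x * P z ^ 3 * Q x
      - 3 * W'.a₁ ^ 2 * W'.a₃ ^ 2 * P x ^ 2 * P z ^ 2 * Q z
      + W'.a₁ ^ 2 * W'.a₃ ^ 2 * W'.a₄ * P z ^ 4 * Q z + W'.a₁ ^ 2 * W'.a₂ * P y ^ 2 * P z ^ 2 * Q x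
      - W'.a₁ ^ 2 * W'.a₂ * P x * P y * P z ^ 2 * Q y
      - 4 * W'.a₁ ^ 2 * W'.a₂ * P x * P y ^ 2 * P z * Q z
      - 6 * W'.a₁ ^ 2 * W'.a₂ * W'.a₆ * P z ^ 4 * Q x
      - W'.a₁ ^ 2 * W'.a₂ * W'.a₄ * P x * P z ^ 3 * Q x
      + 2 * W'.a₁ ^ 2 * W'.a₂ * W'.a₄ * P x ^ 2 * P z ^ 2 * Q z
      + W'.a₁ ^ 2 * W'.a₂ * W'.a₃ * P y * P z ^ 3 * Q x
      - 5 * W'.a₁ ^ 2 * W'.a₂ * W'.a₃ * P x * P y * P z ^ 2 * Q z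
      - W'.a₁ ^ 2 * W'.a₂ * W'.a₃ ^ 2 * P z ^ 4 * Q x
      + W'.a₁ ^ 2 * W'.a₂ ^ 2 * P y ^ 2 * P z ^ 2 * Q z
      - W'.a₁ ^ 2 * W'.a₂ ^ 2 * P x ^ 2 * P z ^ 2 * Q x
      - W'.a₁ ^ 2 * W'.a₂ ^ 2 * W'.a₆ * P z ^ 4 * Q z
      - W'.a₁ ^ 2 * W'.a₂ ^ 2 * W'.a₄ * P x * P z ^ 3 * Q z
      + W'.a₁ ^ 2 * W'.a₂ ^ 2 * W'.a₃ * P y * P z ^ 3 * Q z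
      - W'.a₁ ^ 2 * W'.a₂ ^ 3 * P x ^ 2 * P z ^ 2 * Q z - W'.a₁ ^ 3 * P y ^ 2 * P z ^ 2 * Q y
      - 6 * W'.a₁ ^ 3 * P x ^ 2 * P y * P z * Q x + W'.a₁ ^ 3 * W'.a₄ * P x * P z ^ 3 * Q y
      - W'.a₁ ^ 3 * W'.a₄ * P x * P y * P z ^ 2 * Q z - W'.a₁ ^ 3 * W'.a₃ * P y * P z ^ 3 * Q y
      - W'.a₁ ^ 3 * W'.a₃ * P y ^ 2 * P z ^ 2 * Q z
      - 3 * W'.a₁ ^ 3 * W'.a₃ * P x ^ 2 * P z ^ 2 * Q x + W'.a₁ ^ 3 * W'.a₃ * W'.a₄ * P z ^ 4 * Q x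
      + W'.a₁ ^ 3 * W'.a₃ * W'.a₄ * P x * P z ^ 3 * Q z
      - W'.a₁ ^ 3 * W'.a₃ ^ 2 * P y * P z ^ 3 * Q z + W'.a₁ ^ 3 * W'.a₂ * P x * P y * P z ^ 2 * Q x
      + W'.a₁ ^ 3 * W'.a₂ * P x ^ 2 * P z ^ 2 * Q y - W'.a₁ ^ 3 * W'.a₂ * P x ^ 2 * P y * P z * Q z
      + W'.a₁ ^ 3 * W'.a₂ * W'.a₃ * P x ^ 2 * P z ^ 2 * Q z
      + W'.a₁ ^ 3 * W'.a₂ ^ 2 * P x * P y * P z ^ 2 * Q z - W'.a₁ ^ 4 * P y ^ 2 * P z ^ 2 * Q x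
      - W'.a₁ ^ 4 * P x * P y * P z ^ 2 * Q y + W'.a₁ ^ 4 * W'.a₄ * P x * P z ^ 3 * Q x
      - W'.a₁ ^ 4 * W'.a₃ * P y * P z ^ 3 * Q x - W'.a₁ ^ 4 * W'.a₃ * P x * P y * P z ^ 2 * Q z
      + W'.a₁ ^ 4 * W'.a₂ * P x ^ 2 * P z ^ 2 * Q x
      - W'.a₁ ^ 5 * P x * P y * P z ^ 2 * Q x) * (equation_iff Q).mp hQ

/-- The third minor `add₂X · addY − add₂Y · addX` vanishes wherever `addZ P Q` is not a zero divisor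
(e.g. in a domain with `addZ P Q ≠ 0`). [folklore] -/
theorem add₂X_mul_addY {P Q : Fin 3 → R} (hP : W'.Equation P) (hQ : W'.Equation Q)
    (hZ : W'.addZ P Q ∈ nonZeroDivisors R) :
    W'.add₂X P Q * W'.addY P Q = W'.add₂Y P Q * W'.addX P Q := by
  have h : (W'.add₂X P Q * W'.addY P Q - W'.add₂Y P Q * W'.addX P Q) * W'.addZ P Q = 0 := by
    linear_combination W'.addY P Q * add₂X_mul_addZ hP hQ - W'.addX P Q * add₂Y_mul_addZ hP hQ
  exact sub_eq_zero.mp ((mul_right_mem_nonZeroDivisors_eq_zero_iff hZ).mp h)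

end WeierstrassCurve.Projective
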